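import Mathlib
import Summits.Ventures.PercRepro2.Defs
import Summits.Ventures.PercRepro2.Harris
import Summits.Ventures.PercRepro2.WBern

/-!
# Typed bases of ANY two-copy form (blind cell PercRepro2, mine-1 g14)
proofs/MINE1-WBERN.md §3; the cell's «typed bases» (rows 2′TRI, 2′TBHK, 2′W).

`WBern.lean` expands the W-form of the status law in the typed bases. The mechanism is general:
for ANY function `Φ` of a pair of configurations, the two-copy sum `Σ_{ω₁,ω₂} weight p ω₁ · weight p ω₂ · Φ ω₁ ω₂`
equals `Σ_n typedWeight p n · typedSum Φ n`, where `typedSum Φ n` is the WEIGHT-FREE sum of `Φ` over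
the pairs of edge-count vector `n` (`twoCopy_eq_sum_typed`). Hence every two-copy inequality whose typed
sums are all nonnegative holds for every admissible weight vector (`twoCopy_nonneg_of_typed_nonneg`) —
the Lean form of «coefficientwise (Bernstein) positivity implies positivity for all `p`».
-/

namespace Summit.Ventures.PercRepro2

section TypedBases

variable {E : Type*} [Fintype E] [DecidableEq E] {R : Type*} [CommRing R]

/-- The weight-free typed sum of a two-copy function at the edge-count vector `n`. -/
def typedSum (Φ : Config E → Config E → R) (n : E → ℕ) : R :=
  ∑ x ∈ (Finset.univ : Finset (Config E × Config E)).filter (fun x => typeVec x.1 x.2 = n), Φ x.1 x.2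

/-- **Typed-base expansion of a two-copy sum.** -/
theorem twoCopy_eq_sum_typed (p : E → R) (Φ : Config E → Config E → R) :
    ∑ ω₁ : Config E, ∑ ω₂ : Config E, weight p ω₁ * weight p ω₂ * Φ ω₁ ω₂ =
      ∑ n ∈ (Finset.univ : Finset (Config E × Config E)).image (fun x => typeVec x.1 x.2),
        typedWeight p n * typedSum Φ n := by
  have h2 : ∑ ω₁ : Config E, ∑ ω₂ : Config E, weight p ω₁ * weight p ω₂ * Φ ω₁ ω₂ =
      ∑ x : Config E × Config E, weight p x.1 * weight p x.2 * Φ x.1 x.2 := by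
    rw [← Finset.univ_product_univ, Finset.sum_product]
  rw [h2]
  unfold typedSum
  rw [← Finset.sum_fiberwise_of_maps_to (g := fun x : Config E × Config E => typeVec x.1 x.2)
      (t := (Finset.univ : Finset (Config E × Config E)).image (fun x => typeVec x.1 x.2))
      (fun x hx => Finset.mem_image_of_mem _ hx)]
  refine Finset.sum_congr rfl fun n _ => ?_
  rw [Finset.mul_sum]
  refine Finset.sum_congr rfl fun x hx => ?_
  have hn : typeVec x.1 x.2 = n := (Finset.mem_filter.mp hx).2
  rw [weight_mul_weight_eq_typedWeight, hn]

end TypedBases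

section TypedNonneg

variable {E : Type*} [Fintype E] [DecidableEq E]
  {R : Type*} [CommRing R] [LinearOrder R] [IsStrictOrderedRing R]

/-- **Coefficientwise positivity implies positivity for every admissible weight vector.** -/
theorem twoCopy_nonneg_of_typed_nonneg {p : E → R} (hp : IsProbVec p) (Φ : Config E → Config E → R)
    (h : ∀ n : E → ℕ, 0 ≤ typedSum Φ n) :
    0 ≤ ∑ ω₁ : Config E, ∑ ω₂ : Config E, weight p ω₁ * weight p ω₂ * Φ ω₁ ω₂ := by
  rw [twoCopy_eq_sum_typed]
  exact Finset.sum_nonneg fun n _ => mul_nonneg (typedWeight_nonneg hp n) (h n)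

omit [LinearOrder R] [IsStrictOrderedRing R] in
/-- The typed sums of the status pair kernel are the typed-base coefficients of `WBern.lean`. -/
theorem typedSum_pairKernel {V : Type*} [Fintype V] [DecidableEq V] (ends : E → Sym2 V) (s : V)
    (T F : Finset V) (g h : Finset V → R) (n : E → ℕ) :
    typedSum (pairKernel ends s T F g h) n = typedCoef ends s T F g h n := rfl

end TypedNonneg

end Summit.Ventures.PercRepro2
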